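import Literature.MathematicalPhysics.QuantumLattice.SectorSpectrum
import Summits.HubbardSuperconductivity.HubbardSuperconductivity.Theorems.SsbToEvenTorusLro.Negative.MatrixClausesAndBox
import Summits.HubbardSuperconductivity.HubbardSuperconductivity.Theorems.WcbcsSsbToTorusLRO.Negative.SummitMatrixUniformFloor
import HarnessLib

/-!
# Route `AposterioriCapRg` — crux `SsbToEvenTorusLro` (stmt-HubbardSuperconductivity-1315),
# line `floating-mu-two-sided-pair-transfer`, stub `stub_ladderInduction`: the ONE-RUNG STEPS

Helper file 1/2 of the INDUCTION stub. Fix a real `U`, a side `L ≥ 1`, and write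
`H = hubbardTorus 2 L 1 U`, `P = pairField dWaveFormFactor L`, `Q = PᴴP`,
`E_k = H.minEnergyOn (szSector k 0)` and, for a window `τ`,
`V_k(τ) = span {φ ∈ szSector k 0 | Hφ = Eφ, E ≤ E_k + τ}` (the low manifold of the sector `k`).
The TRANSFER (landed stub `stub_lowManifoldTransfer`, here always a HYPOTHESIS with its constant `K`)
turns ONE bright low-excess unit vector of a sector plus rigidity of `Q` on the low manifold of that
sector into brightness of EVERY unit vector of the low manifold. The RUNG (landed stub
`stub_pairTransferRung`, here a hypothesis instantiated at one sector triple `(n, n+2, n+4)` with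
its constant `C_r`) controls `Pψ ∈ szSector n 0` and `Pᴴψ ∈ szSector (n+4) 0` for a normalised
ground state `ψ` of the middle sector `n + 2`.

* `lis_transfer_of_vector` — the TRANSFER fed with an UNNORMALISED vector `x` of the sector:
  `‖x‖² = S > 0`, `Re⟨x,Hx⟩ ≤ E_n S + t`, `t ≤ θ S`, `B S ≤ Re⟨x,Qx⟩` give, after normalising
  `x` (`exists_smul_unit`, `re_expect_smul`), the floor `B - 4ρL⁴ - K(θ/τ)L⁴` on `V_n(τ)`.
* `stub_ladderInductionRungDown` — the DOWN rung `n + 2 ↦ n`: if every normalised ground state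
  of the middle sector has `Re⟨ψ,Qψ⟩ ≥ F` (and one exists), the window convexity slack is `≤ s`,
  and `Q` is `ρL⁴`-rigid on `V_n(τ)`, then every unit `u ∈ V_n(τ)` has
  `Re⟨u,Qu⟩ ≥ F - C_rL² - 4ρL⁴ - K(θ/τ)L⁴`, provided `θ ≥ s + 4C_rL²/F`, `2θ ≤ τ`, `2C_rL² ≤ F`,
  `s ≤ 1`. Proof: `x = Pψ`, `S = S₋ = Re⟨ψ,Qψ⟩ ≥ F`; in the rung inequality (3) the `Pᴴ`-bracket is
  `≥ 0` by the sector variational principle in the sector `n + 4` (`szSector_groundState`), so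
  `Re⟨Pψ,HPψ⟩ - E_n S₋ ≤ C_rL² + sS₋`; brightness `Re⟨Pψ,QPψ⟩ ≥ S₋² - C_rL²S₋` is rung (4).
* `stub_ladderInductionRungUp` — the UP rung `n + 2 ↦ n + 4`: same with `x = Pᴴψ`,
  `S = S₊ = Re⟨ψ,PPᴴψ⟩`,
  `S₊ ≥ S₋ - C_rL²` (rung (6)), the `P`-bracket dropped by the variational principle in the sector
  `n`, brightness `Re⟨Pᴴψ,QPᴴψ⟩ ≥ S₊²` (rung (5)).

Everything is finite-dimensional bookkeeping over landed tree lemmas; no definition and no named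
fact is introduced. Sources: T. Koma, H. Tasaki, J. Stat. Phys. 76 (1994) 745 (low-lying states
and order, the tower of states); H. Tasaki, *Physics and Mathematics of Quantum Many-Body Systems*
(2020) §2.2 (variational principle in a symmetry sector). All statements are folklore.
-/

noncomputable section

namespace Summit.HubbardSuperconductivity.HubbardSuperconductivity.Theorems

-- summit = problem name (single-conjunct summit), D-0017
set_option linter.dupNamespace false

open Literature.MathematicalPhysics.QuantumLattice Literature.Probability.LatticeModels
open Filter Set Matrix
open scoped ComplexOrder ComplexConjugate

/-! ## §1 Small tools -/

/-- **Sector variational principle** on the torus: `E_{2k} ‖x‖² ≤ Re⟨x, Hx⟩` for every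
`x ∈ szSector (2k) 0`, `k ≤ L²` (`szSector_groundState`). Tasaki (2020) §2.2. [folklore] -/
theorem lis_sector_variational (U : ℝ) (L : ℕ) {k : ℕ} (hk : k ≤ L ^ 2)
    {x : Fock (Orb (FermionTorus 2 L))} (hx : x ∈ szSector (2 * k) 0) :
    (hubbardTorus 2 L 1 U).minEnergyOn (szSector (2 * k) 0) * (star x ⬝ᵥ x).re ≤
      (expect (hubbardTorus 2 L 1 U) x).re := by
  have hcard : Fintype.card (FermionTorus 2 L) = L ^ 2 := by simp [FermionTorus, Fintype.card_lex]
  have hk' : k ≤ Fintype.card (FermionTorus 2 L) := by rwa [hcard]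
  exact (szSector_groundState (fermionTorusGraph 2 L) 1 U hk').2 x
    ((mem_szSector_two_mul_zero_iff k x).1 hx)

/-- A sector ground state lies in the low manifold `V_m(τ)` of its sector for every `τ ≥ 0`
(it is one of the generating eigenvectors). [folklore] -/
theorem lis_groundState_mem_lowManifold {U : ℝ} {L m : ℕ} {τ : ℝ} (hτ : 0 ≤ τ)
    {ψ : Fock (Orb (FermionTorus 2 L))} (hψ : IsGroundStateInSector (hubbardTorus 2 L 1 U) m 0 ψ) :
    ψ ∈ Submodule.span ℂ {φ : Fock (Orb (FermionTorus 2 L)) | φ ∈ szSector m 0 ∧ ∃ E : ℝ,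
      hubbardTorus 2 L 1 U *ᵥ φ = (E : ℂ) • φ ∧
        E ≤ (hubbardTorus 2 L 1 U).minEnergyOn (szSector m 0) + τ} :=
  Submodule.subset_span ⟨hψ.1, _, hψ.2.2, le_add_of_nonneg_right hτ⟩

/-! ## §2 The TRANSFER fed with an unnormalised vector -/

/-- **TRANSFER for an unnormalised bright low-excess vector.** With the TRANSFER as hypothesis
(constant `K`): if `x ∈ szSector n 0` has `‖x‖² = S > 0`, `Re⟨x,Hx⟩ ≤ E_n S + t` with `t ≤ θS`,
and `B S ≤ Re⟨x,Qx⟩`, and `Q` is `ρL⁴`-rigid on `V_n(τ)` (`0 < τ`, `0 ≤ ρ`, `0 ≤ θ`, `2θ ≤ τ`),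
then every unit `u ∈ V_n(τ)` has `B - 4ρL⁴ - K(θ/τ)L⁴ ≤ Re⟨u,Qu⟩`: normalise `x` and apply the
TRANSFER. [folklore] -/
theorem lis_transfer_of_vector {K : ℝ}
    (hT : ∀ (U : ℝ) (L : ℕ) [NeZero L] (n : ℕ) (τ ρ θ B lam : ℝ), 0 < τ → 0 ≤ ρ → 0 ≤ θ → 2 * θ ≤ τ → (∀ v ∈ Submodule.span ℂ {φ : Fock (Orb (FermionTorus 2 L)) | φ ∈ szSector n 0 ∧ ∃ E : ℝ, hubbardTorus 2 L 1 U *ᵥ φ = (E : ℂ) • φ ∧ E ≤ (hubbardTorus 2 L 1 U).minEnergyOn (szSector n 0) + τ}, (star (((pairField dWaveFormFactor L)ᴴ * pairField dWaveFormFactor L) *ᵥ v - ((lam * (L : ℝ) ^ 4 : ℝ) : ℂ) • v) ⬝ᵥ (((pairField dWaveFormFactor L)ᴴ * pairField dWaveFormFactor L) *ᵥ v - ((lam * (L : ℝ) ^ 4 : ℝ) : ℂ) • v)).re ≤ ρ ^ 2 * (L : ℝ) ^ 8 * (star v ⬝ᵥ v).re) → ∀ φ : Fock (Orb (FermionTorus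 2 L)), φ ∈ szSector n 0 → star φ ⬝ᵥ φ = 1 → (expect (hubbardTorus 2 L 1 U) φ).re ≤ (hubbardTorus 2 L 1 U).minEnergyOn (szSector n 0) + θ → B ≤ (expect ((pairField dWaveFormFactor L)ᴴ * pairField dWaveFormFactor L) φ).re → ∀ u ∈ Submodule.span ℂ {φ : Fock (Orb (FermionTorus 2 L)) | φ ∈ szSector n 0 ∧ ∃ E : ℝ, hubbardTorus 2 L 1 U *ᵥ φ = (E : ℂ) • φ ∧ E ≤ (hubbardTorus 2 L 1 U).minEnergyOn (szSector n 0) + τ}, star u ⬝ᵥ u = 1 → B - 4 * ρ * (L : ℝ) ^ 4 - K * (θ / τ) * (L : ℝ) ^ 4 ≤ (expect ((pairField dWaveFormFactor L)ᴴ * pairField dWaveFormFactor L) u).re)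
    (U : ℝ) (L : ℕ) [NeZero L] (n : ℕ) {τ ρ θ lam : ℝ} (hτ : 0 < τ) (hρ : 0 ≤ ρ) (hθ : 0 ≤ θ)
    (hθτ : 2 * θ ≤ τ)
    (hrig : ∀ v ∈ Submodule.span ℂ {φ : Fock (Orb (FermionTorus 2 L)) | φ ∈ szSector n 0 ∧ ∃ E : ℝ,
        hubbardTorus 2 L 1 U *ᵥ φ = (E : ℂ) • φ ∧
          E ≤ (hubbardTorus 2 L 1 U).minEnergyOn (szSector n 0) + τ},
      (star (((pairField dWaveFormFactor L)ᴴ * pairField dWaveFormFactor L) *ᵥ v -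
          ((lam * (L : ℝ) ^ 4 : ℝ) : ℂ) • v) ⬝ᵥ
        (((pairField dWaveFormFactor L)ᴴ * pairField dWaveFormFactor L) *ᵥ v -
          ((lam * (L : ℝ) ^ 4 : ℝ) : ℂ) • v)).re ≤ ρ ^ 2 * (L : ℝ) ^ 8 * (star v ⬝ᵥ v).re)
    {x : Fock (Orb (FermionTorus 2 L))} (hx : x ∈ szSector n 0) {S t B : ℝ}
    (hS : (star x ⬝ᵥ x).re = S) (hS0 : 0 < S)
    (hA : (expect (hubbardTorus 2 L 1 U) x).re ≤
      (hubbardTorus 2 L 1 U).minEnergyOn (szSector n 0) * S + t)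
    (ht : t ≤ θ * S)
    (hB : B * S ≤ (expect ((pairField dWaveFormFactor L)ᴴ * pairField dWaveFormFactor L) x).re) :
    ∀ u ∈ Submodule.span ℂ {φ : Fock (Orb (FermionTorus 2 L)) | φ ∈ szSector n 0 ∧ ∃ E : ℝ,
        hubbardTorus 2 L 1 U *ᵥ φ = (E : ℂ) • φ ∧
          E ≤ (hubbardTorus 2 L 1 U).minEnergyOn (szSector n 0) + τ},
      star u ⬝ᵥ u = 1 → B - 4 * ρ * (L : ℝ) ^ 4 - K * (θ / τ) * (L : ℝ) ^ 4 ≤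
        (expect ((pairField dWaveFormFactor L)ᴴ * pairField dWaveFormFactor L) u).re := by
  intro u hu hu1
  set H := hubbardTorus 2 L 1 U with hH
  set Q := (pairField dWaveFormFactor L)ᴴ * pairField dWaveFormFactor L with hQ
  set E₀ := H.minEnergyOn (szSector n 0) with hE₀
  -- normalise `x`
  have hx0 : x ≠ 0 := by
    intro h
    rw [h, star_zero, zero_dotProduct, Complex.zero_re] at hS
    exact (lt_irrefl (0 : ℝ)) (hS ▸ hS0)
  obtain ⟨c, -, hc1⟩ := exists_smul_unit hx0
  have hcS : ‖c‖ ^ 2 * S = 1 := by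
    have h := SsbToEvenTorusLro.Negative.re_expect_smul (1 : Matrix _ _ ℂ) c x
    simp only [expect, one_mulVec] at h
    rw [hc1, Complex.one_re, hS] at h
    exact h.symm
  have hc2 : 0 ≤ ‖c‖ ^ 2 := sq_nonneg _
  have hφS : c • x ∈ szSector n 0 := Submodule.smul_mem _ c hx
  have hφE : (expect H (c • x)).re ≤ E₀ + θ := by
    rw [SsbToEvenTorusLro.Negative.re_expect_smul]
    have h1 : ‖c‖ ^ 2 * (expect H x).re ≤ ‖c‖ ^ 2 * (E₀ * S + t) :=
      mul_le_mul_of_nonneg_left hA hc2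
    have h2 : ‖c‖ ^ 2 * t ≤ ‖c‖ ^ 2 * (θ * S) := mul_le_mul_of_nonneg_left ht hc2
    have e1 : ‖c‖ ^ 2 * (E₀ * S + t) = E₀ * (‖c‖ ^ 2 * S) + ‖c‖ ^ 2 * t := by ring
    have e2 : ‖c‖ ^ 2 * (θ * S) = θ * (‖c‖ ^ 2 * S) := by ring
    rw [hcS, mul_one] at e1 e2
    linarith only [h1, h2, e1, e2]
  have hφB : B ≤ (expect Q (c • x)).re := by
    rw [SsbToEvenTorusLro.Negative.re_expect_smul]
    have h1 : ‖c‖ ^ 2 * (B * S) ≤ ‖c‖ ^ 2 * (expect Q x).re := mul_le_mul_of_nonneg_left hB hc2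
    have e1 : ‖c‖ ^ 2 * (B * S) = B * (‖c‖ ^ 2 * S) := by ring
    rw [hcS, mul_one] at e1
    linarith only [h1, e1]
  exact hT U L n τ ρ θ B lam hτ hρ hθ hθτ hrig (c • x) hφS hc1 hφE hφB u hu hu1

/-! ## §3 The two rungs -/

/-- **The DOWN rung `n + 2 ↦ n`** of the sector-hopping ladder (see the module docstring): from the
TRANSFER (hypothesis, constant `K`), conjuncts (1)–(4) of the RUNG at the triple `(n, n+2, n+4)`
(hypothesis, constant `C_r`), the convexity slack `2E_{n+2} - E_n - E_{n+4} ≤ s`, a pair-order floor `F` for all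
normalised ground states of the middle sector `n + 2` and `ρL⁴`-rigidity of `PᴴP` on `V_n(τ)`,
every unit vector of `V_n(τ)` has pair order `≥ F - C_rL² - 4ρL⁴ - K(θ/τ)L⁴`
(`n` even, `n + 4 ≤ 2L²`, `0 ≤ C_r`, `0 ≤ s ≤ 1`, `0 < F`, `2C_rL² ≤ F`, `0 < τ`, `0 ≤ ρ`,
`s + 4C_rL²/F ≤ θ`, `2θ ≤ τ`). Koma–Tasaki (1994) §2. [folklore] -/
theorem stub_ladderInductionRungDown : ∀ (K : ℝ), (∀ (U : ℝ) (L : ℕ) [NeZero L] (n : ℕ) (τ ρ θ B lam : ℝ), 0 < τ → 0 ≤ ρ → 0 ≤ θ → 2 * θ ≤ τ → (∀ v ∈ Submodule.span ℂ {φ : Fock (Orb (FermionTorus 2 L)) | φ ∈ szSector n 0 ∧ ∃ E : ℝ, hubbardTorus 2 L 1 U *ᵥ φ = (E : ℂ) • φ ∧ E ≤ (hubbardTorus 2 L 1 U).minEnergyOn (szSector n 0) + τ}, (star (((pairField dWaveFormFactor L)ᴴ * pairField dWaveFormFactor L) *ᵥ v - ((lam * (L : ℝ) ^ 4 : ℝ)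 : ℂ) • v) ⬝ᵥ (((pairField dWaveFormFactor L)ᴴ * pairField dWaveFormFactor L) *ᵥ v - ((lam * (L : ℝ) ^ 4 : ℝ) : ℂ) • v)).re ≤ ρ ^ 2 * (L : ℝ) ^ 8 * (star v ⬝ᵥ v).re) → ∀ φ : Fock (Orb (FermionTorus 2 L)), φ ∈ szSector n 0 → star φ ⬝ᵥ φ = 1 → (expect (hubbardTorus 2 L 1 U) φ).re ≤ (hubbardTorus 2 L 1 U).minEnergyOn (szSector n 0) + θ → B ≤ (expect ((pairField dWaveFormFactor L)ᴴ * pairField dWaveFormFactor L) φ).re → ∀ u ∈ Submodule.span ℂ {φ : Fock (Orb (FermionTorus 2 L)) | φ ∈ szSector n 0 ∧ ∃ E : ℝ, hubbardTorus 2 L 1 U *ᵥ φ = (E : ℂ) • φ ∧ E ≤ (hubbardTorus 2 L 1 U).minEnergyOn (szSector n 0) + τ}, star u ⬝ᵥ u = 1 → B - 4 * ρ * (L : ℝ) ^ 4 - K * (θ / τ) * (L : ℝ) ^ 4 ≤ (expect ((pairField dWaveFormFactor L)ᴴ * pairField dWaveFormFactor L) u).re) → ∀ (U : ℝ) (L :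 ℕ) [NeZero L] (n : ℕ) (Cr s F τ ρ θ lam : ℝ), Even n → n + 4 ≤ 2 * L ^ 2 → 0 ≤ Cr → 0 ≤ s → s ≤ 1 → 0 < F → 2 * Cr * (L : ℝ) ^ 2 ≤ F → 0 < τ → 0 ≤ ρ → s + 4 * Cr * (L : ℝ) ^ 2 / F ≤ θ → 2 * θ ≤ τ → (∀ ψ : Fock (Orb (FermionTorus 2 L)), IsGroundStateInSector (hubbardTorus 2 L 1 U) (n + 2) 0 ψ → star ψ ⬝ᵥ ψ = 1 → pairField dWaveFormFactor L *ᵥ ψ ∈ szSector n 0 ∧ (pairField dWaveFormFactor L)ᴴ *ᵥ ψ ∈ szSector (n + 4) 0 ∧ (expect (hubbardTorus 2 L 1 U) (pairField dWaveFormFactor L *ᵥ ψ)).re - (hubbardTorus 2 L 1 U).minEnergyOn (szSector n 0) * (expect ((pairField dWaveFormFactor L)ᴴ * pairField dWaveFormFactor L) ψ).re + ((expect (hubbardTorus 2 L 1 U) ((pairField dWaveFormFactor L)ᴴ *ᵥ ψ)).re - (hubbardTorus 2 L 1 U).minEnergyOn (szSector (n + 4) 0) * (expect (pairField dWaveFormFactor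 L * (pairField dWaveFormFactor L)ᴴ) ψ).re) ≤ Cr * (L : ℝ) ^ 2 + max 0 (2 * (hubbardTorus 2 L 1 U).minEnergyOn (szSector (n + 2) 0) - (hubbardTorus 2 L 1 U).minEnergyOn (szSector n 0) - (hubbardTorus 2 L 1 U).minEnergyOn (szSector (n + 4) 0)) * (expect ((pairField dWaveFormFactor L)ᴴ * pairField dWaveFormFactor L) ψ).re ∧ (expect ((pairField dWaveFormFactor L)ᴴ * pairField dWaveFormFactor L) ψ).re ^ 2 - Cr * (L : ℝ) ^ 2 * (expect ((pairField dWaveFormFactor L)ᴴ * pairField dWaveFormFactor L) ψ).re ≤ (expect ((pairField dWaveFormFactor L)ᴴ * pairField dWaveFormFactor L) (pairField dWaveFormFactor L *ᵥ ψ)).re) → 2 * (hubbardTorus 2 L 1 U).minEnergyOn (szSector (n + 2) 0) - (hubbardTorus 2 L 1 U).minEnergyOn (szSector n 0) - (hubbardTorus 2 L 1 U).minEnergyOn (szSector (n + 4) 0) ≤ s → (∀ ψ : Fock (Orb (FermionTorus 2 L)), IsGroundStateInSector (hubbardTorus 2 L 1 U) (n + 2) 0 ψ → star ψ ⬝ᵥ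 ψ = 1 → F ≤ (expect ((pairField dWaveFormFactor L)ᴴ * pairField dWaveFormFactor L) ψ).re) → (∀ v ∈ Submodule.span ℂ {φ : Fock (Orb (FermionTorus 2 L)) | φ ∈ szSector n 0 ∧ ∃ E : ℝ, hubbardTorus 2 L 1 U *ᵥ φ = (E : ℂ) • φ ∧ E ≤ (hubbardTorus 2 L 1 U).minEnergyOn (szSector n 0) + τ}, (star (((pairField dWaveFormFactor L)ᴴ * pairField dWaveFormFactor L) *ᵥ v - ((lam * (L : ℝ) ^ 4 : ℝ) : ℂ) • v) ⬝ᵥ (((pairField dWaveFormFactor L)ᴴ * pairField dWaveFormFactor L) *ᵥ v - ((lam * (L : ℝ) ^ 4 : ℝ) : ℂ) • v)).re ≤ ρ ^ 2 * (L : ℝ) ^ 8 * (star v ⬝ᵥ v).re) → ∀ u ∈ Submodule.span ℂ {φ : Fock (Orb (FermionTorus 2 L)) | φ ∈ szSector n 0 ∧ ∃ E : ℝ, hubbardTorus 2 L 1 U *ᵥ φ = (E : ℂ) • φ ∧ E ≤ (hubbardTorus 2 L 1 U).minEnergyOn (szSector n 0) + τ}, star u ⬝ᵥ u = 1 → F -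 Cr * (L : ℝ) ^ 2 - 4 * ρ * (L : ℝ) ^ 4 - K * (θ / τ) * (L : ℝ) ^ 4 ≤ (expect ((pairField dWaveFormFactor L)ᴴ * pairField dWaveFormFactor L) u).re := by
  intro K hT U L _ n Cr s F τ ρ θ lam hn hn4 hCr hs hs1 hF hCrF hτ hρ hθ hθτ hR hconv hfloor hrig
  obtain ⟨k, rfl⟩ : ∃ k, n = 2 * k := by
    obtain ⟨r, hr⟩ := hn
    exact ⟨r, by omega⟩
  -- a normalised ground state of the middle sector `2k + 2`
  obtain ⟨ψ, hψ1, hgs⟩ :=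
    WcbcsSsbToTorusLRO.Negative.exists_unit_groundStateInSector L U (n := k + 1) (by omega)
  rw [show 2 * (k + 1) = 2 * k + 2 by ring] at hgs
  obtain ⟨h1, h2, h3, h4⟩ := hR ψ hgs hψ1
  have hFS := hfloor ψ hgs hψ1
  set H := hubbardTorus 2 L 1 U with hH
  set P := pairField dWaveFormFactor L with hP
  -- Gram identities `S₋ = ‖Pψ‖²`, `S₊ = ‖Pᴴψ‖²`
  have hGm : expect (Pᴴ * P) ψ = star (P *ᵥ ψ) ⬝ᵥ (P *ᵥ ψ) :=
    PosSemidefTrace.expect_conjTranspose_mul P P ψ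
  have hGp : expect (P * Pᴴ) ψ = star (Pᴴ *ᵥ ψ) ⬝ᵥ (Pᴴ *ᵥ ψ) := by
    rw [← PosSemidefTrace.expect_conjTranspose_mul, conjTranspose_conjTranspose]
  set Sm := (expect (Pᴴ * P) ψ).re with hSm
  set Sp := (expect (P * Pᴴ) ψ).re with hSp
  have hSm0 : 0 ≤ Sm := hF.le.trans hFS
  have hL2 : (0 : ℝ) ≤ Cr * (L : ℝ) ^ 2 := by positivity
  -- the `Pᴴ`-bracket of the rung inequality is `≥ 0` (variational principle in sector `2k + 4`)
  have hvar : H.minEnergyOn (szSector (2 * k + 4) 0) * Sp ≤ (expect H (Pᴴ *ᵥ ψ)).re := by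
    have h2' : Pᴴ *ᵥ ψ ∈ szSector (2 * (k + 2)) 0 := by
      rw [show 2 * (k + 2) = 2 * k + 4 by ring]; exact h2
    have h := lis_sector_variational U L (k := k + 2) (by omega) h2'
    rw [show 2 * (k + 2) = 2 * k + 4 by ring, ← hGp] at h
    exact h
  have hmax : max 0 (2 * H.minEnergyOn (szSector (2 * k + 2) 0) - H.minEnergyOn (szSector (2 * k) 0) -
      H.minEnergyOn (szSector (2 * k + 4) 0)) * Sm ≤ s * Sm :=
    mul_le_mul_of_nonneg_right (max_le hs hconv) hSm0
  -- excess of `x = Pψ`: `Re⟨Pψ,HPψ⟩ ≤ E_n S₋ + (C_rL² + sS₋)`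
  have hA : (expect H (P *ᵥ ψ)).re ≤
      H.minEnergyOn (szSector (2 * k) 0) * Sm + (Cr * (L : ℝ) ^ 2 + s * Sm) := by
    linarith only [h3, hvar, hmax]
  -- `t ≤ θ S₋`
  have hq : 4 * Cr * (L : ℝ) ^ 2 ≤ 4 * Cr * (L : ℝ) ^ 2 / F * Sm := by
    rw [div_mul_eq_mul_div, le_div_iff₀ hF]
    exact mul_le_mul_of_nonneg_left hFS (by positivity)
  have hθS : (s + 4 * Cr * (L : ℝ) ^ 2 / F) * Sm ≤ θ * Sm := mul_le_mul_of_nonneg_right hθ hSm0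
  have ht : Cr * (L : ℝ) ^ 2 + s * Sm ≤ θ * Sm := by
    have e : (s + 4 * Cr * (L : ℝ) ^ 2 / F) * Sm = s * Sm + 4 * Cr * (L : ℝ) ^ 2 / F * Sm := by ring
    linarith only [hθS, hq, e, hL2]
  have hθ0 : 0 ≤ θ := by
    have : 0 ≤ 4 * Cr * (L : ℝ) ^ 2 / F := by positivity
    linarith only [hθ, hs, this]
  -- brightness of `x = Pψ`: rung (4)
  have hB : (Sm - Cr * (L : ℝ) ^ 2) * Sm ≤ (expect (Pᴴ * P) (P *ᵥ ψ)).re := by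
    have e : (Sm - Cr * (L : ℝ) ^ 2) * Sm = Sm ^ 2 - Cr * (L : ℝ) ^ 2 * Sm := by ring
    rw [e]; exact h4
  have hS : (star (P *ᵥ ψ) ⬝ᵥ (P *ᵥ ψ)).re = Sm := by rw [hSm, hGm]
  have key :=
    lis_transfer_of_vector hT U L (2 * k) hτ hρ hθ0 hθτ hrig h1 hS (hF.trans_le hFS) hA ht hB
  intro u hu hu1
  have := key u hu hu1
  linarith only [this, hFS]

/-- **The UP rung `n + 2 ↦ n + 4`** of the sector-hopping ladder (see the module docstring): as
`stub_ladderInductionRungDown` (but with all six RUNG conjuncts), with rigidity of `PᴴP` on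
`V_{n+4}(τ)` and conclusion on `V_{n+4}(τ)`; the transferred vector is `Pᴴψ`, whose norm
`S₊ ≥ S₋ - C_rL² ≥ F/2` is controlled by rung (6).
Koma–Tasaki (1994) §2. [folklore] -/
theorem stub_ladderInductionRungUp : ∀ (K : ℝ), (∀ (U : ℝ) (L : ℕ) [NeZero L] (n : ℕ) (τ ρ θ B lam : ℝ), 0 < τ → 0 ≤ ρ → 0 ≤ θ → 2 * θ ≤ τ → (∀ v ∈ Submodule.span ℂ {φ : Fock (Orb (FermionTorus 2 L)) | φ ∈ szSector n 0 ∧ ∃ E : ℝ, hubbardTorus 2 L 1 U *ᵥ φ = (E : ℂ) • φ ∧ E ≤ (hubbardTorus 2 L 1 U).minEnergyOn (szSector n 0) + τ}, (star (((pairField dWaveFormFactor L)ᴴ * pairField dWaveFormFactor L) *ᵥ v - ((lam * (L : ℝ) ^ 4 : ℝ) : ℂ) • v) ⬝ᵥ (((pairField dWaveFormFactor L)ᴴ * pairField dWaveFormFactor L) *ᵥ v - ((lam * (L : ℝ) ^ 4 : ℝ) : ℂ) • v)).re ≤ ρ ^ 2 * (L : ℝ) ^ 8 * (star v ⬝ᵥ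 v).re) → ∀ φ : Fock (Orb (FermionTorus 2 L)), φ ∈ szSector n 0 → star φ ⬝ᵥ φ = 1 → (expect (hubbardTorus 2 L 1 U) φ).re ≤ (hubbardTorus 2 L 1 U).minEnergyOn (szSector n 0) + θ → B ≤ (expect ((pairField dWaveFormFactor L)ᴴ * pairField dWaveFormFactor L) φ).re → ∀ u ∈ Submodule.span ℂ {φ : Fock (Orb (FermionTorus 2 L)) | φ ∈ szSector n 0 ∧ ∃ E : ℝ, hubbardTorus 2 L 1 U *ᵥ φ = (E : ℂ) • φ ∧ E ≤ (hubbardTorus 2 L 1 U).minEnergyOn (szSector n 0) + τ}, star u ⬝ᵥ u = 1 → B - 4 * ρ * (L : ℝ) ^ 4 - K * (θ / τ) * (L : ℝ) ^ 4 ≤ (expect ((pairField dWaveFormFactor L)ᴴ * pairField dWaveFormFactor L) u).re) → ∀ (U : ℝ) (L : ℕ) [NeZero L] (n : ℕ) (Cr s F τ ρ θ lam : ℝ), Even n → n + 4 ≤ 2 * L ^ 2 → 0 ≤ Cr → 0 ≤ s → s ≤ 1 → 0 < F → 2 * Cr * (L : ℝ) ^ 2 ≤ F → 0 < τ → 0 ≤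 ρ → s + 4 * Cr * (L : ℝ) ^ 2 / F ≤ θ → 2 * θ ≤ τ → (∀ ψ : Fock (Orb (FermionTorus 2 L)), IsGroundStateInSector (hubbardTorus 2 L 1 U) (n + 2) 0 ψ → star ψ ⬝ᵥ ψ = 1 → pairField dWaveFormFactor L *ᵥ ψ ∈ szSector n 0 ∧ (pairField dWaveFormFactor L)ᴴ *ᵥ ψ ∈ szSector (n + 4) 0 ∧ (expect (hubbardTorus 2 L 1 U) (pairField dWaveFormFactor L *ᵥ ψ)).re - (hubbardTorus 2 L 1 U).minEnergyOn (szSector n 0) * (expect ((pairField dWaveFormFactor L)ᴴ * pairField dWaveFormFactor L) ψ).re + ((expect (hubbardTorus 2 L 1 U) ((pairField dWaveFormFactor L)ᴴ *ᵥ ψ)).re - (hubbardTorus 2 L 1 U).minEnergyOn (szSector (n + 4) 0) * (expect (pairField dWaveFormFactor L * (pairField dWaveFormFactor L)ᴴ) ψ).re) ≤ Cr * (L : ℝ) ^ 2 + max 0 (2 * (hubbardTorus 2 L 1 U).minEnergyOn (szSector (n + 2) 0) - (hubbardTorus 2 L 1 U).minEnergyOn (szSector n 0) - (hubbardTorus 2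 L 1 U).minEnergyOn (szSector (n + 4) 0)) * (expect ((pairField dWaveFormFactor L)ᴴ * pairField dWaveFormFactor L) ψ).re ∧ (expect ((pairField dWaveFormFactor L)ᴴ * pairField dWaveFormFactor L) ψ).re ^ 2 - Cr * (L : ℝ) ^ 2 * (expect ((pairField dWaveFormFactor L)ᴴ * pairField dWaveFormFactor L) ψ).re ≤ (expect ((pairField dWaveFormFactor L)ᴴ * pairField dWaveFormFactor L) (pairField dWaveFormFactor L *ᵥ ψ)).re ∧ (expect (pairField dWaveFormFactor L * (pairField dWaveFormFactor L)ᴴ) ψ).re ^ 2 ≤ (expect ((pairField dWaveFormFactor L)ᴴ * pairField dWaveFormFactor L) ((pairField dWaveFormFactor L)ᴴ *ᵥ ψ)).re ∧ |(expect (pairField dWaveFormFactor L * (pairField dWaveFormFactor L)ᴴ) ψ).re - (expect ((pairField dWaveFormFactor L)ᴴ * pairField dWaveFormFactor L) ψ).re| ≤ Cr * (L : ℝ) ^ 2) → 2 * (hubbardTorus 2 L 1 U).minEnergyOn (szSector (n + 2) 0) - (hubbardTorus 2 L 1 U).minEnergyOn (szSector n 0) - (hubbardTorus 2 L 1 U).minEnergyOn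 (szSector (n + 4) 0) ≤ s → (∀ ψ : Fock (Orb (FermionTorus 2 L)), IsGroundStateInSector (hubbardTorus 2 L 1 U) (n + 2) 0 ψ → star ψ ⬝ᵥ ψ = 1 → F ≤ (expect ((pairField dWaveFormFactor L)ᴴ * pairField dWaveFormFactor L) ψ).re) → (∀ v ∈ Submodule.span ℂ {φ : Fock (Orb (FermionTorus 2 L)) | φ ∈ szSector (n + 4) 0 ∧ ∃ E : ℝ, hubbardTorus 2 L 1 U *ᵥ φ = (E : ℂ) • φ ∧ E ≤ (hubbardTorus 2 L 1 U).minEnergyOn (szSector (n + 4) 0) + τ}, (star (((pairField dWaveFormFactor L)ᴴ * pairField dWaveFormFactor L) *ᵥ v - ((lam * (L : ℝ) ^ 4 : ℝ) : ℂ) • v) ⬝ᵥ (((pairField dWaveFormFactor L)ᴴ * pairField dWaveFormFactor L) *ᵥ v - ((lam * (L : ℝ) ^ 4 : ℝ) : ℂ) • v)).re ≤ ρ ^ 2 * (L : ℝ) ^ 8 * (star v ⬝ᵥ v).re) → ∀ u ∈ Submodule.span ℂ {φ : Fock (Orb (FermionTorus 2 L)) | φ ∈ szSector (n + 4) 0 ∧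 ∃ E : ℝ, hubbardTorus 2 L 1 U *ᵥ φ = (E : ℂ) • φ ∧ E ≤ (hubbardTorus 2 L 1 U).minEnergyOn (szSector (n + 4) 0) + τ}, star u ⬝ᵥ u = 1 → F - Cr * (L : ℝ) ^ 2 - 4 * ρ * (L : ℝ) ^ 4 - K * (θ / τ) * (L : ℝ) ^ 4 ≤ (expect ((pairField dWaveFormFactor L)ᴴ * pairField dWaveFormFactor L) u).re := by
  intro K hT U L _ n Cr s F τ ρ θ lam hn hn4 hCr hs hs1 hF hCrF hτ hρ hθ hθτ hR hconv hfloor hrig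
  obtain ⟨k, rfl⟩ : ∃ k, n = 2 * k := by
    obtain ⟨r, hr⟩ := hn
    exact ⟨r, by omega⟩
  -- a normalised ground state of the middle sector `2k + 2`
  obtain ⟨ψ, hψ1, hgs⟩ :=
    WcbcsSsbToTorusLRO.Negative.exists_unit_groundStateInSector L U (n := k + 1) (by omega)
  rw [show 2 * (k + 1) = 2 * k + 2 by ring] at hgs
  obtain ⟨h1, h2, h3, -, h5, h6⟩ := hR ψ hgs hψ1
  have hFS := hfloor ψ hgs hψ1
  set H := hubbardTorus 2 L 1 U with hH
  set P := pairField dWaveFormFactor L with hP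
  -- Gram identities `S₋ = ‖Pψ‖²`, `S₊ = ‖Pᴴψ‖²`
  have hGm : expect (Pᴴ * P) ψ = star (P *ᵥ ψ) ⬝ᵥ (P *ᵥ ψ) :=
    PosSemidefTrace.expect_conjTranspose_mul P P ψ
  have hGp : expect (P * Pᴴ) ψ = star (Pᴴ *ᵥ ψ) ⬝ᵥ (Pᴴ *ᵥ ψ) := by
    rw [← PosSemidefTrace.expect_conjTranspose_mul, conjTranspose_conjTranspose]
  set Sm := (expect (Pᴴ * P) ψ).re with hSm
  set Sp := (expect (P * Pᴴ) ψ).re with hSp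
  have hSm0 : 0 ≤ Sm := hF.le.trans hFS
  have hL2 : (0 : ℝ) ≤ Cr * (L : ℝ) ^ 2 := by positivity
  -- `S₊ ≥ S₋ - C_rL² ≥ F/2 > 0` (rung (6))
  have hSpm : Sm - Cr * (L : ℝ) ^ 2 ≤ Sp := by
    have := (abs_le.1 h6).1
    linarith only [this]
  have hSpF : F - Cr * (L : ℝ) ^ 2 ≤ Sp := by linarith only [hSpm, hFS]
  have hSp0 : 0 < Sp := by linarith only [hSpF, hCrF, hF]
  -- the `P`-bracket of the rung inequality is `≥ 0` (variational principle in sector `2k`)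
  have hvar : H.minEnergyOn (szSector (2 * k) 0) * Sm ≤ (expect H (P *ᵥ ψ)).re := by
    have h := lis_sector_variational U L (k := k) (by omega) h1
    rw [← hGm] at h
    exact h
  have hmax : max 0 (2 * H.minEnergyOn (szSector (2 * k + 2) 0) - H.minEnergyOn (szSector (2 * k) 0) -
      H.minEnergyOn (szSector (2 * k + 4) 0)) * Sm ≤ s * Sm :=
    mul_le_mul_of_nonneg_right (max_le hs hconv) hSm0
  -- excess of `x = Pᴴψ`: `Re⟨Pᴴψ,HPᴴψ⟩ ≤ E_{n+4} S₊ + (C_rL² + sS₋)`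
  have hA : (expect H (Pᴴ *ᵥ ψ)).re ≤
      H.minEnergyOn (szSector (2 * k + 4) 0) * Sp + (Cr * (L : ℝ) ^ 2 + s * Sm) := by
    linarith only [h3, hvar, hmax]
  -- `t ≤ θ S₊`
  have hq : 2 * Cr * (L : ℝ) ^ 2 ≤ 4 * Cr * (L : ℝ) ^ 2 / F * Sp := by
    rw [div_mul_eq_mul_div, le_div_iff₀ hF]
    have : 4 * Cr * (L : ℝ) ^ 2 * (F - Cr * (L : ℝ) ^ 2) ≤ 4 * Cr * (L : ℝ) ^ 2 * Sp :=
      mul_le_mul_of_nonneg_left hSpF (by positivity)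
    nlinarith only [this, hCrF, hL2, hF]
  have hθS : (s + 4 * Cr * (L : ℝ) ^ 2 / F) * Sp ≤ θ * Sp := mul_le_mul_of_nonneg_right hθ hSp0.le
  have hsL : s * (Cr * (L : ℝ) ^ 2) ≤ Cr * (L : ℝ) ^ 2 := mul_le_of_le_one_left hL2 hs1
  have hsm : s * Sm ≤ s * (Sp + Cr * (L : ℝ) ^ 2) :=
    mul_le_mul_of_nonneg_left (by linarith only [hSpm]) hs
  have ht : Cr * (L : ℝ) ^ 2 + s * Sm ≤ θ * Sp := by
    have e : (s + 4 * Cr * (L : ℝ) ^ 2 / F) * Sp = s * Sp + 4 * Cr * (L : ℝ) ^ 2 / F * Sp := by ring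
    have e2 : s * (Sp + Cr * (L : ℝ) ^ 2) = s * Sp + s * (Cr * (L : ℝ) ^ 2) := by ring
    linarith only [hθS, hq, e, e2, hsL, hsm]
  have hθ0 : 0 ≤ θ := by
    have : 0 ≤ 4 * Cr * (L : ℝ) ^ 2 / F := by positivity
    linarith only [hθ, hs, this]
  -- brightness of `x = Pᴴψ`: rung (5)
  have hB : Sp * Sp ≤ (expect (Pᴴ * P) (Pᴴ *ᵥ ψ)).re := by
    rw [← sq]; exact h5
  have hS : (star (Pᴴ *ᵥ ψ) ⬝ᵥ (Pᴴ *ᵥ ψ)).re = Sp := by rw [hSp, hGp]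
  have key := lis_transfer_of_vector hT U L (2 * k + 4) hτ hρ hθ0 hθτ hrig h2 hS hSp0 hA ht hB
  intro u hu hu1
  have := key u hu hu1
  linarith only [this, hSpF]

end Summit.HubbardSuperconductivity.HubbardSuperconductivity.Theorems

end
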